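import Mathlib.Data.ZMod.Basic
import Mathlib.Data.Nat.Squarefree
import Literature.NumberTheory.EllipticCurves.GlobalMinimalModel
import Literature.NumberTheory.DiophantineGeometry.Conductor
import HarnessLib

/-!
# Kolyvagin primes of level `k` for Kato's Euler system (`𝒫_k`, `𝒩_k`)

The auxiliary primes of the *cyclotomic* Kolyvagin-system machinery applied to Kato's Euler
system of an elliptic curve `E / ℚ` at a prime `p` (Mazur–Rubin, *Kolyvagin systems*, Mem. AMS
799 (2004); Kurihara 2014; C.-H. Kim 2022): for an integer `k ≥ 1`,

  `𝒫_k = {ℓ prime : (ℓ, N p) = 1, ℓ ≡ 1 (mod p^k), a_ℓ(E) ≡ ℓ + 1 (mod p^k)}`,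

`N` the conductor of `E` (Kim, arXiv:2203.12159, §1.2.2, verbatim; §2.4.1: *"which we call the set
of Kolyvagin primes for `T/p^kT`"*, `T = T_p E`), and `𝒩_k` = the set of square-free products of
primes in `𝒫_k` (*"Note that `1 ∈ 𝒩_k` for every `k` by convention. Obviously `𝒫_{k+1} ⊆ 𝒫_k`
and `𝒩_{k+1} ⊆ 𝒩_k`"*, §1.4.2). These are the levels `n ∈ 𝒩_1` at which the Kurihara numbers
`δ̃_n = Σ_{a ∈ (ℤ/n)ˣ} [a/n]⁺ · Π_{ℓ ∣ n} log_{η_ℓ}(a)` live (Kim §1.4.3), and the primes at which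
the Kolyvagin derivative classes `κ_n^{Kato}` of Kato's zeta elements are formed (Kim §2.3).

## Contents

* `Kato.IsKolyvaginPrime W p k ℓ` — `ℓ ∈ 𝒫_k` for the curve `E = W` (a globally minimal
  Weierstrass equation over `ℚ`, so that `a_ℓ = W.frobeniusTrace ℓ` and `N = W.conductorNorm ℤ`
  are the tree's trace of Frobenius and conductor): `ℓ` prime, `ℓ ∤ N·p`, `ℓ ≡ 1 (mod p^k)`,
  `a_ℓ ≡ ℓ + 1 (mod p^k)`.
* `Kato.IsKolyvaginProduct W p k n` — `n ∈ 𝒩_k`: `n` square-free with every prime factor in `𝒫_k`.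
* API (all proved): the printed coprimality form `(ℓ, Np) = 1` (`IsKolyvaginPrime.coprime`,
  `isKolyvaginPrime_iff_coprime`), `ℓ ≠ p`, `ℓ ∤ N`, the monotonicity `𝒫_{k+1} ⊆ 𝒫_k`,
  `𝒩_{k+1} ⊆ 𝒩_k` (`.mono`), `1 ∈ 𝒩_k` (`IsKolyvaginProduct.one`), the equivalent reading
  `p^k ∣ #Ẽ(𝔽_ℓ)` of the trace congruence (`IsKolyvaginPrime.pow_dvd_reductionPointCount`:
  `#Ẽ(𝔽_ℓ) = ℓ + 1 - a_ℓ`), and the `ZMod` forms of the two congruences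
  (`isKolyvaginPrime_iff_zmod`: `(ℓ : ZMod (p^k)) = 1 ∧ (a_ℓ : ZMod (p^k)) = 2`; at `k = 1`,
  `isKolyvaginPrime_one_iff`: `(ℓ : ZMod p) = 1 ∧ (a_ℓ : ZMod p) = 2`, the form in which route
  statements had been inlining the condition).

## Faithfulness and design notes

* **Which "Kolyvagin primes".** This is the cyclotomic notion (Kato's Euler system over the
  fields `ℚ(μ_n)`), *not* Gross's anticyclotomic notion for Heegner points relative to an
  imaginary quadratic field `K` (`ℓ ∤ N·D·p` inert in `K` with `Frob(ℓ) = Frob(∞)` in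
  `Gal(K(E_p)/ℚ)`, whence `a_ℓ ≡ ℓ + 1 ≡ 0 (mod p)`), which is the tree's
  `Literature.NumberTheory.EllipticCurves.IsKolyvaginPrime N W K p ℓ`
  (file `HeegnerPointsKolyvaginEulerSystem`). To keep the two apart the present declarations live
  in the sub-namespace `Kato` of the path namespace (it names the Euler system;
  `Kato.IsKolyvaginPrime W p k ℓ`). Here `ℓ ≡ 1 (mod p^k)`, there `ℓ ≡ -1 (mod p)`.
* **As printed.** Kim's three conditions are recorded literally: `(ℓ, Np) = 1` as `ℓ ∤ N·p`
  (equivalent for a prime `ℓ`, `isKolyvaginPrime_iff_coprime`), with `N = W.conductorNorm ℤ` the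
  conductor `N_E` of the tree (`Literature.NumberTheory.DiophantineGeometry.Conductor`; for a prime
  `ℓ`, `ℓ ∣ N_E` iff `E` has bad reduction at `ℓ`, the tree's theorem
  `WeierstrassCurve.dvd_conductorNorm_iff_not_hasGoodReductionAtPrime`, file
  `ModularityVersionApProofs`, not imported here to keep this definition's import cone small), and
  `a_ℓ(E) = W.frobeniusTrace ℓ = ℓ + 1 - #Ẽ(𝔽_ℓ)` the trace of Frobenius of the reduction of the
  global minimal model (`GlobalMinimalModel`), whence the standing instance `[W.IsGloballyMinimal]`
  (every `E / ℚ` has such a model: `WeierstrassCurve.hasGlobalMinimalModel_rat`). Both congruences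
  are taken modulo the natural number `p ^ k` (`Nat.ModEq`, resp. `Int.ModEq` with modulus
  `((p ^ k : ℕ) : ℤ)` since `a_ℓ ∈ ℤ`).
* **Mazur–Rubin's form.** Kim's `I_ℓ = (ℓ - 1, a_ℓ - ℓ - 1) ℤ_p` (§1.2.2) is Mazur–Rubin's ideal
  generated by `ℓ - 1` and `P_ℓ(1) = det(1 - Fr_ℓ | T) = 1 - a_ℓ + ℓ`, and `ℓ ∈ 𝒫_k` iff `ℓ ∤ Np`
  and `I_ℓ ⊆ p^k ℤ_p`; the primes supplied by the Čebotarev density theorem are those whose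
  Frobenius in `Gal(ℚ(E[p^k], μ_{p^k})/ℚ)` is the class of complex conjugation. Neither the ideal
  `I_ℓ` nor any existence / density statement is vendored here (the latter are theorems requiring
  Čebotarev and an image hypothesis on `ρ_{E,p}`; cf. the anticyclotomic analogue
  `McCallum1991_cor_3_2_eigen`).
* **Variants NOT recorded.** Kurihara (2014, §3.1) works with `𝒫_good = {good ℓ} \ {p}`,
  `𝒫^{(N)} = {ℓ ∈ 𝒫_good : ℓ ≡ 1 (mod p^N)}` and its subsets `𝒫_0^{(N)}` (`E(𝔽_ℓ)[p^N]` has a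
  point of order `p^N`; since `det ρ(Fr_ℓ) = ℓ ≡ 1`, this implies `a_ℓ ≡ ℓ + 1 (mod p^N)`, i.e.
  `𝒫_0^{(N)} ⊆ 𝒫_N`, with equality for `N = 1`) and `𝒫_1^{(N)}` (`E(𝔽_ℓ)[p^N] ≃ ℤ/p^N`); Ota
  (2018, Thm. 1.5) uses good primes `ℓ ≡ 1 (mod p)` with `E(𝔽_ℓ)[p]` cyclic. A route needing the cyclicity of
  `Ẽ(𝔽_ℓ)[p]` should conjoin it separately (e.g. `IsAddCyclic` of
  `AddSubgroup.torsionBy Ẽ(𝔽_ℓ) p` for the points `Ẽ(𝔽_ℓ)` of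
  `(W.integralModelInt).map (Int.castRingHom (ZMod ℓ))`); it is not part of `𝒫_k`.
* **Junk values.** The definition is meaningful for `W` elliptic, `p` prime and `k ≥ 1`. For
  `k = 0` both congruences are vacuous (`𝒫_0` = all primes `ℓ ∤ Np`); for `p = 0` and `k ≥ 1` the
  condition `ℓ ∤ N·0 = 0` fails, so `𝒫_k = ∅`; for singular `W` the conductor is the junk value
  `1` of `WeierstrassCurve.conductorNorm`.
* Example (not shipped; checked numerically): for `E = 37a1` (`y² + y = x³ - x`, `N = 37`,
  `ρ̄_{E,5}` surjective) and `p = 5`, `k = 1`, the prime `ℓ = 61` lies in `𝒫_1`: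
  `61 ≡ 1 (mod 5)`, `#Ẽ(𝔽_61) = 70`, `a_61 = -8 ≡ 62 (mod 5)`.

## References

* C.-H. Kim, *The structure of Selmer groups and the Iwasawa main conjecture for elliptic curves*,
  arXiv:2203.12159 (Amer. J. Math., to appear): §1.2.2 (definition of `𝒫_k`, `𝒩_k`, `I_ℓ`,
  `I_n`), §1.4.2–1.4.3 (conventions, Kurihara numbers), §2.4.1. [Kim2022StructureSelmer]
* M. Kurihara, *The structure of Selmer groups of elliptic curves and modular symbols*, in
  *Iwasawa Theory 2012*, Contrib. Math. Comput. Sci. 7, Springer (2014), 317–356 =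
  arXiv:1407.2465: §3.1. [Kurihara2014]
* B. Mazur, K. Rubin, *Kolyvagin systems*, Mem. Amer. Math. Soc. 168 (2004), no. 799 (not held;
  cited through Kim, §2). [MazurRubin2004]
* K. Ota, *Kato's Euler system and the Mazur–Tate refined conjecture of BSD type*, Amer. J. Math.
  140 (2018) = arXiv:1509.00682: Thm. 1.5.
-/

noncomputable section

open scoped Classical

namespace Literature.NumberTheory.EllipticCurves.Kato

open WeierstrassCurve

variable (W : WeierstrassCurve ℚ) [W.IsGloballyMinimal] (p k : ℕ)

/-- **Kolyvagin primes of level `k` for `T_p E`** (`ℓ ∈ 𝒫_k`). Kim, arXiv:2203.12159, §1.2.2,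
verbatim: *"Let `E` be an elliptic curve over `ℚ` of conductor `N` and `p ≥ 5` a prime. … Let
`k ≥ 1` be an integer. Let `𝒫_k = {ℓ, a prime : (ℓ, Np) = 1, ℓ ≡ 1 (mod p^k),
a_ℓ(E) ≡ ℓ + 1 (mod p^k)}`"* (§2.4.1: *"which we call the set of Kolyvagin primes for
`T/p^kT`"*). Recorded for a globally minimal Weierstrass equation `W` of `E` as the conjunction:
`ℓ` is prime; `ℓ ∤ N·p` with `N = W.conductorNorm ℤ` the conductor (equivalently `(ℓ, Np) = 1`,
`isKolyvaginPrime_iff_coprime`); `ℓ ≡ 1 (mod p^k)`; and `a_ℓ ≡ ℓ + 1 (mod p^k)` with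
`a_ℓ = W.frobeniusTrace ℓ = ℓ + 1 - #Ẽ(𝔽_ℓ)` (equivalently `p^k ∣ #Ẽ(𝔽_ℓ)`,
`IsKolyvaginPrime.pow_dvd_reductionPointCount`). The cyclotomic (Kato) notion — distinct from
Gross's anticyclotomic `Literature.NumberTheory.EllipticCurves.IsKolyvaginPrime` (Heegner points);
see the module docstring, also for the junk cases `k = 0`, `p = 0`, `W` singular.
[cite: Kim2022StructureSelmer, §1.2.2] -/
def IsKolyvaginPrime (ℓ : ℕ) : Prop :=
  ℓ.Prime ∧ ¬ ℓ ∣ W.conductorNorm ℤ * p ∧ ℓ ≡ 1 [MOD p ^ k] ∧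
    W.frobeniusTrace ℓ ≡ ℓ + 1 [ZMOD ((p ^ k : ℕ) : ℤ)]

/-- **Square-free products of Kolyvagin primes of level `k`** (`n ∈ 𝒩_k`). Kim,
arXiv:2203.12159, §1.2.2: *"and `𝒩_k` the set of square-free products of primes in `𝒫_k`"*;
§1.4.2: *"Note that `1 ∈ 𝒩_k` for every `k` by convention."* Recorded as: `n` is square-free and
every prime factor of `n` lies in `𝒫_k` (`Nat.primeFactors`; `n = 1` qualifies, `n = 0` does not).
[cite: Kim2022StructureSelmer, §1.2.2] -/
def IsKolyvaginProduct (n : ℕ) : Prop :=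
  Squarefree n ∧ ∀ ℓ ∈ n.primeFactors, IsKolyvaginPrime W p k ℓ

variable {W p k}

/-! ### Elementary API -/

/-- A Kolyvagin prime is a prime. [folklore] -/
theorem IsKolyvaginPrime.prime {ℓ : ℕ} (h : IsKolyvaginPrime W p k ℓ) : ℓ.Prime :=
  h.1

/-- A Kolyvagin prime does not divide `N·p`. [folklore] -/
theorem IsKolyvaginPrime.not_dvd {ℓ : ℕ} (h : IsKolyvaginPrime W p k ℓ) :
    ¬ ℓ ∣ W.conductorNorm ℤ * p :=
  h.2.1

/-- A Kolyvagin prime does not divide the conductor `N`. [folklore] -/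
theorem IsKolyvaginPrime.not_dvd_conductorNorm {ℓ : ℕ} (h : IsKolyvaginPrime W p k ℓ) :
    ¬ ℓ ∣ W.conductorNorm ℤ :=
  fun hd ↦ h.not_dvd (hd.mul_right p)

/-- A Kolyvagin prime is different from `p`. [folklore] -/
theorem IsKolyvaginPrime.ne {ℓ : ℕ} (h : IsKolyvaginPrime W p k ℓ) : ℓ ≠ p :=
  fun he ↦ h.not_dvd (he ▸ dvd_mul_left ℓ _)

/-- The printed coprimality `(ℓ, Np) = 1` (Kim, §1.2.2). [cite: Kim2022StructureSelmer, §1.2.2] -/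
theorem IsKolyvaginPrime.coprime {ℓ : ℕ} (h : IsKolyvaginPrime W p k ℓ) :
    ℓ.Coprime (W.conductorNorm ℤ * p) :=
  h.prime.coprime_iff_not_dvd.mpr h.not_dvd

/-- `ℓ ≡ 1 (mod p^k)`. [folklore] -/
theorem IsKolyvaginPrime.modEq_one {ℓ : ℕ} (h : IsKolyvaginPrime W p k ℓ) : ℓ ≡ 1 [MOD p ^ k] :=
  h.2.2.1

/-- `a_ℓ ≡ ℓ + 1 (mod p^k)`. [folklore] -/
theorem IsKolyvaginPrime.frobeniusTrace_modEq {ℓ : ℕ} (h : IsKolyvaginPrime W p k ℓ) :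
    W.frobeniusTrace ℓ ≡ ℓ + 1 [ZMOD ((p ^ k : ℕ) : ℤ)] :=
  h.2.2.2

/-- The definition with Kim's printed coprimality condition `(ℓ, Np) = 1` in place of `ℓ ∤ Np`
(the two agree for a prime `ℓ`, `Nat.Prime.coprime_iff_not_dvd`).
[cite: Kim2022StructureSelmer, §1.2.2] -/
theorem isKolyvaginPrime_iff_coprime {ℓ : ℕ} :
    IsKolyvaginPrime W p k ℓ ↔ ℓ.Prime ∧ ℓ.Coprime (W.conductorNorm ℤ * p) ∧ ℓ ≡ 1 [MOD p ^ k] ∧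
      W.frobeniusTrace ℓ ≡ ℓ + 1 [ZMOD ((p ^ k : ℕ) : ℤ)] :=
  and_congr_right fun hℓ ↦ by rw [hℓ.coprime_iff_not_dvd]

/-- **`p^k ∣ #Ẽ(𝔽_ℓ)` at a Kolyvagin prime of level `k`**: since `a_ℓ = ℓ + 1 - #Ẽ(𝔽_ℓ)`
(`WeierstrassCurve.frobeniusTrace`, `WeierstrassCurve.reductionPointCount`), the congruence
`a_ℓ ≡ ℓ + 1 (mod p^k)` says exactly that `p^k` divides the number of `𝔽_ℓ`-points of the
reduction (the form in which `I_ℓ ⊆ p^k ℤ_p` is used: `ℤ/p^k` is a quotient of `Ẽ(𝔽_ℓ)` when the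
`p`-part of the latter is cyclic). [folklore] -/
theorem IsKolyvaginPrime.pow_dvd_reductionPointCount {ℓ : ℕ} (h : IsKolyvaginPrime W p k ℓ) :
    p ^ k ∣ W.reductionPointCount ℓ := by
  have hd := h.frobeniusTrace_modEq.dvd
  rw [WeierstrassCurve.frobeniusTrace, sub_sub_cancel] at hd
  exact Int.natCast_dvd_natCast.mp hd

/-- Conversely, for a prime `ℓ ∤ Np` with `ℓ ≡ 1 (mod p^k)`, the divisibility `p^k ∣ #Ẽ(𝔽_ℓ)`
gives `ℓ ∈ 𝒫_k`. [folklore] -/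
theorem isKolyvaginPrime_of_pow_dvd_reductionPointCount {ℓ : ℕ} (hℓ : ℓ.Prime)
    (hN : ¬ ℓ ∣ W.conductorNorm ℤ * p) (h1 : ℓ ≡ 1 [MOD p ^ k])
    (hc : p ^ k ∣ W.reductionPointCount ℓ) : IsKolyvaginPrime W p k ℓ := by
  refine ⟨hℓ, hN, h1, ?_⟩
  rw [Int.modEq_iff_dvd, WeierstrassCurve.frobeniusTrace, sub_sub_cancel]
  exact Int.natCast_dvd_natCast.mpr hc

/-- **`𝒫_k ⊆ 𝒫_j` for `j ≤ k`** (Kim, §1.4.2: *"Obviously, `𝒫_{k+1} ⊆ 𝒫_k`"*).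
[cite: Kim2022StructureSelmer, §1.4.2] -/
theorem IsKolyvaginPrime.mono {j : ℕ} (hjk : j ≤ k) {ℓ : ℕ} (h : IsKolyvaginPrime W p k ℓ) :
    IsKolyvaginPrime W p j ℓ :=
  ⟨h.prime, h.not_dvd, h.modEq_one.of_dvd (pow_dvd_pow p hjk),
    h.frobeniusTrace_modEq.of_dvd (Int.natCast_dvd_natCast.mpr (pow_dvd_pow p hjk))⟩

/-- **The two congruences in `ZMod (p^k)`**: `ℓ ∈ 𝒫_k` iff `ℓ` is a prime not dividing `Np` with
`(ℓ : ℤ/p^k) = 1` and `(a_ℓ : ℤ/p^k) = 2` (the second congruence reads `a_ℓ = ℓ + 1 = 2` in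
`ℤ/p^k` once `ℓ = 1` there). [folklore] -/
theorem isKolyvaginPrime_iff_zmod {ℓ : ℕ} :
    IsKolyvaginPrime W p k ℓ ↔ ℓ.Prime ∧ ¬ ℓ ∣ W.conductorNorm ℤ * p ∧
      (ℓ : ZMod (p ^ k)) = 1 ∧ (W.frobeniusTrace ℓ : ZMod (p ^ k)) = 2 := by
  have h3 : ℓ ≡ 1 [MOD p ^ k] ↔ (ℓ : ZMod (p ^ k)) = 1 := by
    rw [← ZMod.natCast_eq_natCast_iff, Nat.cast_one]
  have h4 : (ℓ : ZMod (p ^ k)) = 1 →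
      (W.frobeniusTrace ℓ ≡ ℓ + 1 [ZMOD ((p ^ k : ℕ) : ℤ)] ↔
        (W.frobeniusTrace ℓ : ZMod (p ^ k)) = 2) := by
    intro hℓ
    rw [← ZMod.intCast_eq_intCast_iff, Int.cast_add, Int.cast_natCast, Int.cast_one, hℓ,
      one_add_one_eq_two]
  unfold IsKolyvaginPrime
  rw [h3]
  exact and_congr_right fun _ ↦ and_congr_right fun _ ↦ and_congr_right h4

/-- **Level `1`, the form inlined in route statements**: `ℓ ∈ 𝒫_1` iff `ℓ` is a prime with
`ℓ ∤ Np`, `(ℓ : ZMod p) = 1` and `(a_ℓ : ZMod p) = 2` (i.e. `ℓ ≡ 1`, `a_ℓ ≡ ℓ + 1 ≡ 2 (mod p)`).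
[folklore] -/
theorem isKolyvaginPrime_one_iff {ℓ : ℕ} :
    IsKolyvaginPrime W p 1 ℓ ↔ ℓ.Prime ∧ ¬ ℓ ∣ W.conductorNorm ℤ * p ∧
      (ℓ : ZMod p) = 1 ∧ (W.frobeniusTrace ℓ : ZMod p) = 2 := by
  rw [isKolyvaginPrime_iff_zmod, pow_one]

/-! ### Square-free products -/

/-- `1 ∈ 𝒩_k` (Kim, §1.4.2: *"Note that `1 ∈ 𝒩_k` for every `k` by convention"*; here it is a
consequence of the definition, `1` being square-free without prime factors).
[cite: Kim2022StructureSelmer, §1.4.2] -/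
theorem IsKolyvaginProduct.one : IsKolyvaginProduct W p k 1 :=
  ⟨squarefree_one, fun ℓ hℓ ↦ by simp at hℓ⟩

/-- An element of `𝒩_k` is square-free. [folklore] -/
theorem IsKolyvaginProduct.squarefree {n : ℕ} (h : IsKolyvaginProduct W p k n) : Squarefree n :=
  h.1

/-- An element of `𝒩_k` is non-zero. [folklore] -/
theorem IsKolyvaginProduct.ne_zero {n : ℕ} (h : IsKolyvaginProduct W p k n) : n ≠ 0 :=
  h.squarefree.ne_zero

/-- Every prime factor of `n ∈ 𝒩_k` is a Kolyvagin prime of level `k`. [folklore] -/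
theorem IsKolyvaginProduct.isKolyvaginPrime {n ℓ : ℕ} (h : IsKolyvaginProduct W p k n)
    (hℓ : ℓ.Prime) (hd : ℓ ∣ n) : IsKolyvaginPrime W p k ℓ :=
  h.2 ℓ (Nat.mem_primeFactors.mpr ⟨hℓ, hd, h.ne_zero⟩)

/-- A Kolyvagin prime of level `k` is itself in `𝒩_k`. [folklore] -/
theorem IsKolyvaginPrime.isKolyvaginProduct {ℓ : ℕ} (h : IsKolyvaginPrime W p k ℓ) :
    IsKolyvaginProduct W p k ℓ :=
  ⟨Irreducible.squarefree h.prime, fun q hq ↦ by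
    rw [h.prime.primeFactors, Finset.mem_singleton] at hq
    exact hq ▸ h⟩

/-- An element of `𝒩_k` is coprime to `N·p` (all its prime factors are). [folklore] -/
theorem IsKolyvaginProduct.coprime {n : ℕ} (h : IsKolyvaginProduct W p k n) :
    n.Coprime (W.conductorNorm ℤ * p) :=
  Nat.coprime_of_dvd fun _ hℓ hℓn hℓN ↦ (h.isKolyvaginPrime hℓ hℓn).not_dvd hℓN

/-- **`𝒩_k ⊆ 𝒩_j` for `j ≤ k`** (Kim, §1.4.2: *"Obviously … `𝒩_{k+1} ⊆ 𝒩_k`"*).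
[cite: Kim2022StructureSelmer, §1.4.2] -/
theorem IsKolyvaginProduct.mono {j : ℕ} (hjk : j ≤ k) {n : ℕ} (h : IsKolyvaginProduct W p k n) :
    IsKolyvaginProduct W p j n :=
  ⟨h.1, fun ℓ hℓ ↦ (h.2 ℓ hℓ).mono hjk⟩

/-- `𝒩_k` is closed under products of coprime elements (square-freeness is multiplicative on
coprime factors). [folklore] -/
theorem IsKolyvaginProduct.mul {m n : ℕ} (hm : IsKolyvaginProduct W p k m)
    (hn : IsKolyvaginProduct W p k n) (hmn : m.Coprime n) : IsKolyvaginProduct W p k (m * n) :=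
  ⟨(Nat.squarefree_mul hmn).mpr ⟨hm.1, hn.1⟩, fun ℓ hℓ ↦ by
    rw [Nat.primeFactors_mul hm.ne_zero hn.ne_zero, Finset.mem_union] at hℓ
    rcases hℓ with h | h
    exacts [hm.2 ℓ h, hn.2 ℓ h]⟩

/-- A divisor of an element of `𝒩_k` is in `𝒩_k`. [folklore] -/
theorem IsKolyvaginProduct.of_dvd {m n : ℕ} (hn : IsKolyvaginProduct W p k n) (hmn : m ∣ n) :
    IsKolyvaginProduct W p k m :=
  ⟨Squarefree.squarefree_of_dvd hmn hn.1, fun ℓ hℓ ↦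
    hn.2 ℓ (Nat.primeFactors_mono hmn hn.ne_zero hℓ)⟩

end Literature.NumberTheory.EllipticCurves.Kato

end
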